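import Summits.CriticalPhenomena.PercolationContinuityZ3.Theorems.PercNearOneGluingNoHeavyQuantIndepBlobFarMin
import Summits.CriticalPhenomena.PercolationContinuityZ3.Theorems.PercNearOneGluingNoHeavyQuantLawCombMixture
import HarnessLib

/-!
# QUANT lane R8, FAR on general trees — the ROOT REDUCTION (T-RED of README V185): independent root structures with
# finite count laws, two-point components `{lo sure, hi; g}`, the exact expansion into TERMS (a sure shift plus ONE
# independent blob per structure), and the HEAVY + SURE row proved unconditionally

builds on p205010 (kernel theorem, internal audit signed; external expert review pending)

Support file (`--supports stmt-CriticalPhenomena-4575`), QUANT lane typer seat prim-quant-stmt (gen 17), rung R8 of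
`run/shared/lean/prim/quant/LADDER.md`.  Asked for by the gen-15 lead (README V185, lane HANDOFF GEN-15 (b) "T-RED = the root
reduction identity with sure parts and layer shift — typer") on the ARCHITECTURE OF RECORD of prim-quant-census-2 g49
(`prim-quant-census-2-g49/ARCH-TREES-G49.md` §2): `Quant.FarTreeRow ⟸ DEC ∧ DIB*`.  Theorems only (local notation, no
definitions), no sorries, standard axioms.

**The root model.**  Finitely many STRUCTURES `k : κ` hang at the observer; structure `k` contributes an integer count with
LAW `μ k : ℕ → ℝ` (intended support `⊆ {0, …, M k}`), independently of the others.  The probability that the total count is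
`≥ j+1` is `RTAIL[M, μ, j] = Σ_{c ∈ Π_k {0..M k}} (Π_k μ k (c k)) · 𝟙[j+1 ≤ Σ_k c k]` — the law-comb `GTAIL` of
`…QuantLawCombMixture` (p1 g10) with NO chain (`D = 0`, `rtail_eq_gtail_zero`); on a rooted forest with independent vertex
gates the structures are the trees of the forest and `μ k` the law of the number of relays of tree `k` joined to its root
(gate coordinates: `Quant.LawCombGate.real_lawCount_eq_sum`, p1 g10).

**Two-point components.**  `TP[lo, hi, g] = g·δ_hi + (1 − g)·δ_lo` (`lo ≤ hi`): `lo` SURE relays plus ONE blob of `hi − lo`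
relays behind a gate of conditional weight `g`.  If every structure law is a finite mixture `μ k = Σ_r λ k r · TP[lo k r, hi k r, g k r]`
then, by multilinearity, `RTAIL = Σ_σ (Π_k λ k (σ k)) · TERM_σ` (`rtail_eq_sum_terms`), where the TERM of the choice function `σ`
is `TERM[s, a, g, j] = P(s + Σ_{k open} a k ≥ j+1)` for INDEPENDENT blobs `(a k, g k) = (hi − lo, g) k (σ k)`, one per structure,
and the sure shift `s = Σ_k lo k (σ k)` — no tree and no chain left (ARCH-TREES-G49 §0).  A sure relay lowers the layer
(`P(s + X ≥ j+1) = P(X ≥ j−s+1)`), so against `Quant.IndepBlob.far_indepBlob_support` at layer `j − s` it is worth CREDIT 2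
while a blob relay behind `g ≥ x` is worth `g` (`term_ge_of_budget`).

* `sum_cfg_prod_twoPoint` — expectation of any `F` against a product of two-point laws = expectation over the open set `W`.
* `rtail_twoPoint_eq_term`, `rtail_eq_gtail_zero`, `rtail_eq_sum_mixture`, `rtail_eq_sum_terms` — the identities.
* `rtail_ge_of_terms` (R1) — if every GENUINE term (`λ k (σ k) > 0` for all `k`) has `TERM_σ ≥ x` then `RTAIL ≥ x`.
* term certificates: `term_eq_one_of_sure` (β: `s ≥ j+1`), `gate_le_term_of_giant` (α: a blob with `s + a k ≥ j+1` gives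
  `TERM ≥ g k`), `term_eq_one_sub`, `term_ge_of_budget` (FAR for independent blobs with a sure shift: live gates `≥ x`,
  `2j < 2s + Σ a g ⟹ TERM ≥ x`).
* `rtail_ge_of_heavyDec` (R2) — **THE HEAVY + SURE ROW, unconditional**: if every structure law is a mixture of two-point
  components whose genuine members have gates in `[0,1]`, `g ≥ x` whenever the blob is non-empty (`lo < hi`), and CREDIT
  `2·lo + (hi − lo)·g ≥ cr k`, and `Σ_k cr k > 2j` (e.g. `cr k` = the mean of structure `k`, `Σ_k cr k = EN`), then `RTAIL ≥ x`
  (`0 ≤ x ≤ 1`).  This is the lead's observation LEAD-NOTES-G15 N26 (2) as a theorem: at the root every RELIABLE gated star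
  (e.g. the unit triple `h = 4/5, γ = 9/10` that refutes mean-preserving mixtures, README V186) is inside `far_indepBlob` +
  layer shift.  LIGHT components (gate below the floor, discounted credit) are the business of Conjecture DIB\*
  (ARCH-TREES-G49 §3), typed separately; `rtail_ge_of_terms` is the socket they plug into.

[this work]; architecture: prim-quant-census-2 g49 ARCH-TREES-G49 (this lane); product weights [cite: Grimmett1999, §1.3 p. 10];
the gluing rows served [cite: KozmaNitzan2024, Conjecture 3 (p. 15)].
-/

namespace Summit.CriticalPhenomena.PercolationContinuityZ3.Theorems

namespace Quant

namespace RootDec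

open Finset

variable {κ : Type*} [Fintype κ] [DecidableEq κ]

/-- configurations of structure counts bounded by `M` -/
local notation3 "cfg[" M "]" => Fintype.piFinset (fun k : κ => Finset.range ((M : κ → ℕ) k + 1))

/-- the ROOT tail `P(N ≥ j+1)`: independent structures `k` with count laws `μ k` on `{0..M k}` -/
local notation3 "RTAIL[" M ", " μ ", " j "]" =>
  ∑ c ∈ cfg[M], (∏ k, (μ : κ → ℕ → ℝ) k ((c : κ → ℕ) k)) * (if (j : ℕ) + 1 ≤ ∑ k, (c : κ → ℕ) k then (1 : ℝ) else 0)

/-- the two-point law `{lo, hi; g}`: `hi` with probability `g`, `lo` with probability `1 − g` -/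
local notation3 "TP[" lo ", " hi ", " g ", " h "]" =>
  (g : ℝ) * (if (h : ℕ) = (hi : ℕ) then (1 : ℝ) else 0) + (1 - (g : ℝ)) * (if (h : ℕ) = (lo : ℕ) then (1 : ℝ) else 0)

/-- product-Bernoulli weight of the set `W` of structures whose blob is open -/
local notation3 "wt[" g ", " W "]" => ∏ k, (if k ∈ (W : Finset κ) then (g : κ → ℝ) k else 1 - (g : κ → ℝ) k)

/-- the TERM tail: sure mass `s` plus independent blobs `(a k, g k)`, `P(s + Σ_{k open} a k ≥ j+1)` -/
local notation3 "TERM[" s ", " a ", " g ", " j "]" =>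
  ∑ W : Finset κ, wt[g, W] * (if (j : ℕ) + 1 ≤ (s : ℕ) + ∑ k ∈ W, (a : κ → ℕ) k then (1 : ℝ) else 0)

/-- depth law of a chain (copied from `…QuantLawCombMixture`, used only at `D = 0`) -/
local notation3 "pd[" D ", " q ", " i "]" =>
  (∏ i' ∈ Finset.range (i : ℕ), (q : ℕ → ℝ) i') * (if (i : ℕ) < (D : ℕ) then 1 - (q : ℕ → ℝ) i else 1)

/-- the law-comb tail of `…QuantLawCombMixture` (copied verbatim) -/
local notation3 "GTAIL[" D ", " q ", " lv ", " M ", " μ ", " j "]" =>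
  ∑ i ∈ Finset.range ((D : ℕ) + 1), pd[D, q, i] *
    ∑ c ∈ cfg[M], (∏ k, (μ : κ → ℕ → ℝ) k ((c : κ → ℕ) k)) *
      (if (j : ℕ) + 1 ≤ ∑ k ∈ Finset.univ.filter (fun k => (lv : κ → ℕ) k ≤ (i : ℕ)), (c : κ → ℕ) k then (1 : ℝ) else 0)

/-! ### 1. Expectation against a product of two-point laws -/

/-- **Expansion of a product of two-point laws.**  For `lo ≤ hi ≤ M` and any function `F` of the configuration,
`Σ_{c ∈ cfg M} (Π_k TP[lo k, hi k, g k](c k))·F c = Σ_{W ⊆ κ} wt[g, W]·F(c_W)`, `c_W k = hi k` (`k ∈ W`) or `lo k` (`k ∉ W`):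
the structures' counts are independent two-valued variables. [this work] -/
theorem sum_cfg_prod_twoPoint (M lo hi : κ → ℕ) (g : κ → ℝ) (hlohi : ∀ k, lo k ≤ hi k) (hhi : ∀ k, hi k ≤ M k)
    (F : (κ → ℕ) → ℝ) :
    ∑ c ∈ cfg[M], (∏ k, TP[lo k, hi k, g k, c k]) * F c =
      ∑ W : Finset κ, wt[g, W] * F (fun k => if k ∈ W then hi k else lo k) := by
  -- expand the product over the set `W` of structures whose blob is open
  have hexp : ∀ c : κ → ℕ, (∏ k, TP[lo k, hi k, g k, c k]) =
      ∑ W : Finset κ, wt[g, W] * (if c = (fun k => if k ∈ W then hi k else lo k) then (1 : ℝ) else 0) := by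
    intro c
    have h1 : (∏ k, TP[lo k, hi k, g k, c k]) = ∑ W : Finset κ, ∏ k,
        (if k ∈ W then g k * (if c k = hi k then (1 : ℝ) else 0) else (1 - g k) * (if c k = lo k then (1 : ℝ) else 0)) := by
      rw [IndepBlob.sum_prod_ite_mem]
    rw [h1]
    refine Finset.sum_congr rfl fun W _ => ?_
    by_cases hc : c = (fun k => if k ∈ W then hi k else lo k)
    · rw [if_pos hc, mul_one]
      refine Finset.prod_congr rfl fun k _ => ?_
      have hck : c k = if k ∈ W then hi k else lo k := by rw [hc]
      by_cases hk : k ∈ W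
      · rw [if_pos hk] at hck
        rw [if_pos hk, if_pos hk, if_pos hck, mul_one]
      · rw [if_neg hk] at hck
        rw [if_neg hk, if_neg hk, if_pos hck, mul_one]
    · rw [if_neg hc, mul_zero]
      obtain ⟨k, hk⟩ : ∃ k, ¬ (c k = if k ∈ W then hi k else lo k) := not_forall.1 fun hall => hc (funext hall)
      refine Finset.prod_eq_zero (Finset.mem_univ k) ?_
      by_cases hkW : k ∈ W
      · rw [if_pos hkW] at hk
        rw [if_pos hkW, if_neg hk, mul_zero]
      · rw [if_neg hkW] at hk
        rw [if_neg hkW, if_neg hk, mul_zero]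
  simp_rw [hexp, Finset.sum_mul]
  rw [Finset.sum_comm]
  refine Finset.sum_congr rfl fun W _ => ?_
  -- only the configuration `c_W` survives, and it is admissible
  have hmem : (fun k => if k ∈ W then hi k else lo k) ∈ cfg[M] := by
    rw [Fintype.mem_piFinset]
    intro k
    rw [Finset.mem_range]
    by_cases hk : k ∈ W
    · rw [if_pos hk]; exact Nat.lt_succ_of_le (hhi k)
    · rw [if_neg hk]; exact Nat.lt_succ_of_le ((hlohi k).trans (hhi k))
  rw [Finset.sum_eq_single_of_mem _ hmem (fun c _ hc => by rw [if_neg hc, mul_zero, zero_mul])]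
  rw [if_pos rfl, mul_one]

/-- The count of the configuration `c_W`: `Σ_k c_W k = Σ_k lo k + Σ_{k ∈ W} (hi k − lo k)` (`lo ≤ hi`). [this work] -/
theorem sum_cfgOf_eq (lo hi : κ → ℕ) (hlohi : ∀ k, lo k ≤ hi k) (W : Finset κ) :
    ∑ k, (if k ∈ W then hi k else lo k) = ∑ k, lo k + ∑ k ∈ W, (hi k - lo k) := by
  have h1 : ∀ k, (if k ∈ W then hi k else lo k) = lo k + (if k ∈ W then hi k - lo k else 0) := by
    intro k
    by_cases hk : k ∈ W
    · rw [if_pos hk, if_pos hk, Nat.add_sub_cancel' (hlohi k)]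
    · rw [if_neg hk, if_neg hk, Nat.add_zero]
  simp_rw [h1]
  rw [Finset.sum_add_distrib, Finset.sum_ite_mem, Finset.univ_inter]

/-! ### 2. The identities -/

/-- **A product of two-point laws is ONE term**: `RTAIL[M, TP[lo, hi, g], j] = TERM[Σ lo, hi − lo, g, j]` (`lo ≤ hi ≤ M`). [this work] -/
theorem rtail_twoPoint_eq_term (M lo hi : κ → ℕ) (g : κ → ℝ) (hlohi : ∀ k, lo k ≤ hi k) (hhi : ∀ k, hi k ≤ M k) (j : ℕ) :
    RTAIL[M, (fun k h => TP[lo k, hi k, g k, h]), j] = TERM[∑ k, lo k, (fun k => hi k - lo k), g, j] := by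
  rw [sum_cfg_prod_twoPoint M lo hi g hlohi hhi (fun c => if j + 1 ≤ ∑ k, c k then (1 : ℝ) else 0)]
  refine Finset.sum_congr rfl fun W _ => ?_
  simp only []
  rw [sum_cfgOf_eq lo hi hlohi W]

/-- **The root model is the law-comb with no chain**: `RTAIL[M, μ, j] = GTAIL[0, q, 0, M, μ, j]` for any `q`. [this work] -/
theorem rtail_eq_gtail_zero (q : ℕ → ℝ) (M : κ → ℕ) (μ : κ → ℕ → ℝ) (j : ℕ) :
    RTAIL[M, μ, j] = GTAIL[0, q, (fun _ : κ => 0), M, μ, j] := by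
  rw [zero_add, Finset.sum_range_one]
  have hpd : pd[0, q, 0] = 1 := by simp
  rw [hpd, one_mul]
  refine Finset.sum_congr rfl fun c _ => ?_
  have hf : Finset.univ.filter (fun _ : κ => (0 : ℕ) ≤ 0) = Finset.univ := Finset.filter_true_of_mem fun _ _ => le_refl 0
  rw [hf]

/-- **Multilinearity of the root tail in the structure laws**: `μ k = Σ_r λ k r · ν k r ⟹ RTAIL(μ) = Σ_σ (Π_k λ k (σ k))·RTAIL(ν ∘ σ)`. [this work] -/
theorem rtail_eq_sum_mixture {ρ : Type*} [Fintype ρ] [DecidableEq ρ] (M : κ → ℕ) (μ : κ → ℕ → ℝ) (lam : κ → ρ → ℝ)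
    (ν : κ → ρ → ℕ → ℝ) (hμ : ∀ k h, μ k h = ∑ r, lam k r * ν k r h) (j : ℕ) :
    RTAIL[M, μ, j] = ∑ σ : κ → ρ, (∏ k, lam k (σ k)) * RTAIL[M, (fun k => ν k (σ k)), j] := by
  have h1 : ∀ c : κ → ℕ, (∏ k, μ k (c k)) = ∑ σ : κ → ρ, (∏ k, lam k (σ k)) * ∏ k, ν k (σ k) (c k) := by
    intro c
    simp_rw [hμ]
    rw [Finset.prod_univ_sum]
    simp only [Fintype.piFinset_univ]
    exact Finset.sum_congr rfl fun σ _ => by rw [← Finset.prod_mul_distrib]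
  have hL : RTAIL[M, μ, j] = ∑ c ∈ cfg[M], ∑ σ : κ → ρ,
      (∏ k, lam k (σ k)) * ((∏ k, ν k (σ k) (c k)) * (if j + 1 ≤ ∑ k, c k then (1 : ℝ) else 0)) := by
    refine Finset.sum_congr rfl fun c _ => ?_
    rw [h1 c, Finset.sum_mul]
    exact Finset.sum_congr rfl fun σ _ => by ring
  rw [hL, Finset.sum_comm]
  refine Finset.sum_congr rfl fun σ _ => ?_
  rw [Finset.mul_sum]

/-- **THE ROOT REDUCTION IDENTITY.**  If every structure law is a finite mixture of two-point laws,
`μ k = Σ_r λ k r · TP[lo k r, hi k r, g k r]` with `lo ≤ hi ≤ M k`, then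
`RTAIL[M, μ, j] = Σ_σ (Π_k λ k (σ k)) · TERM[Σ_k lo k (σ k), (hi − lo) ∘ σ, g ∘ σ, j]`: a mixture of tails of a SURE mass plus
independent blobs, one blob per structure (ARCH-TREES-G49 §2.3). [this work] -/
theorem rtail_eq_sum_terms {ρ : Type*} [Fintype ρ] [DecidableEq ρ] (M : κ → ℕ) (μ : κ → ℕ → ℝ) (lam : κ → ρ → ℝ)
    (lo hi : κ → ρ → ℕ) (g : κ → ρ → ℝ) (hμ : ∀ k h, μ k h = ∑ r, lam k r * TP[lo k r, hi k r, g k r, h])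
    (hlohi : ∀ k r, lo k r ≤ hi k r) (hhi : ∀ k r, hi k r ≤ M k) (j : ℕ) :
    RTAIL[M, μ, j] = ∑ σ : κ → ρ, (∏ k, lam k (σ k)) *
      TERM[∑ k, lo k (σ k), (fun k => hi k (σ k) - lo k (σ k)), (fun k => g k (σ k)), j] := by
  rw [rtail_eq_sum_mixture M μ lam (fun k r h => TP[lo k r, hi k r, g k r, h]) hμ j]
  refine Finset.sum_congr rfl fun σ _ => ?_
  rw [← rtail_twoPoint_eq_term M (fun k => lo k (σ k)) (fun k => hi k (σ k)) (fun k => g k (σ k))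
    (fun k => hlohi k (σ k)) (fun k => hhi k (σ k)) j]

/-- **R1 — every genuine term above the floor ⟹ the row.**  With the data of `rtail_eq_sum_terms`, `λ ≥ 0`, `Σ_r λ k r = 1`:
if `x ≤ TERM_σ` for every choice function `σ` all of whose components are genuine (`λ k (σ k) > 0`), then `x ≤ RTAIL[M, μ, j]`. [this work] -/
theorem rtail_ge_of_terms {ρ : Type*} [Fintype ρ] [DecidableEq ρ] (M : κ → ℕ) (μ : κ → ℕ → ℝ) (lam : κ → ρ → ℝ)
    (lo hi : κ → ρ → ℕ) (g : κ → ρ → ℝ) (hlam0 : ∀ k r, 0 ≤ lam k r) (hlam1 : ∀ k, ∑ r, lam k r = 1)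
    (hμ : ∀ k h, μ k h = ∑ r, lam k r * TP[lo k r, hi k r, g k r, h])
    (hlohi : ∀ k r, lo k r ≤ hi k r) (hhi : ∀ k r, hi k r ≤ M k) (j : ℕ) (x : ℝ)
    (hrow : ∀ σ : κ → ρ, (∀ k, 0 < lam k (σ k)) →
      x ≤ TERM[∑ k, lo k (σ k), (fun k => hi k (σ k) - lo k (σ k)), (fun k => g k (σ k)), j]) :
    x ≤ RTAIL[M, μ, j] := by
  rw [rtail_eq_sum_terms M μ lam lo hi g hμ hlohi hhi j]
  have hw0 : ∀ σ : κ → ρ, 0 ≤ ∏ k, lam k (σ k) := fun σ => Finset.prod_nonneg fun k _ => hlam0 k (σ k)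
  have hw1 : (∑ σ : κ → ρ, ∏ k, lam k (σ k)) = 1 := by
    have := (Finset.prod_univ_sum (fun (_ : κ) => (Finset.univ : Finset ρ)) (fun k r => lam k r)).symm
    simp only [Fintype.piFinset_univ] at this
    rw [this]
    exact Finset.prod_eq_one fun k _ => hlam1 k
  have hxw : x = ∑ σ : κ → ρ, (∏ k, lam k (σ k)) * x := by rw [← Finset.sum_mul, hw1, one_mul]
  rw [hxw]
  refine Finset.sum_le_sum fun σ _ => ?_
  by_cases hpos : ∀ k, 0 < lam k (σ k)
  · exact mul_le_mul_of_nonneg_left (hrow σ hpos) (hw0 σ)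
  · obtain ⟨k, hk⟩ : ∃ k, ¬ 0 < lam k (σ k) := not_forall.1 hpos
    have h0 : lam k (σ k) = 0 := le_antisymm (not_lt.1 hk) (hlam0 k (σ k))
    have hprod : (∏ k, lam k (σ k)) = 0 := Finset.prod_eq_zero (Finset.mem_univ k) h0
    rw [hprod, zero_mul, zero_mul]

/-! ### 3. Term certificates -/

/-- **β — sure mass suffices**: `j + 1 ≤ s ⟹ TERM[s, a, g, j] = 1`. [this work] -/
theorem term_eq_one_of_sure (s : ℕ) (a : κ → ℕ) (g : κ → ℝ) (j : ℕ) (hs : j + 1 ≤ s) : TERM[s, a, g, j] = 1 := by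
  refine Eq.trans (Finset.sum_congr rfl fun W _ => ?_) (IndepBlob.sum_bernoulliWeight g)
  rw [if_pos (hs.trans (Nat.le_add_right _ _)), mul_one]

/-- **α — a giant decides alone**: if blob `k` has `j + 1 ≤ s + a k` then `g k ≤ TERM[s, a, g, j]` (gates in `[0,1]`). [this work] -/
theorem gate_le_term_of_giant (s : ℕ) (a : κ → ℕ) (g : κ → ℝ) (j : ℕ) (hg : ∀ k, 0 ≤ g k ∧ g k ≤ 1) (k : κ)
    (hk : j + 1 ≤ s + a k) : g k ≤ TERM[s, a, g, j] := by
  rw [← IndepBlob.sum_bernoulliWeight_mul_indicator g k]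
  refine Finset.sum_le_sum fun W _ => mul_le_mul_of_nonneg_left ?_
    (IndepBlob.bernoulliWeight_nonneg (fun i => (hg i).1) (fun i => (hg i).2) W)
  by_cases hkW : k ∈ W
  · rw [if_pos hkW, if_pos (hk.trans (Nat.add_le_add_left (Finset.single_le_sum (fun i _ => Nat.zero_le (a i)) hkW) s))]
  · rw [if_neg hkW]
    split_ifs <;> norm_num

/-- Complement form: for `s ≤ j`, `TERM[s, a, g, j] = 1 − P(Σ_{k open} a k ≤ j − s)`. [this work] -/
theorem term_eq_one_sub (s : ℕ) (a : κ → ℕ) (g : κ → ℝ) (j : ℕ) (hs : s ≤ j) :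
    TERM[s, a, g, j] = 1 - ∑ W ∈ (Finset.univ : Finset (Finset κ)).filter (fun W => ∑ k ∈ W, a k ≤ j - s), wt[g, W] := by
  rw [Finset.sum_filter]
  have h1 : (1 : ℝ) - ∑ W : Finset κ, (if ∑ k ∈ W, a k ≤ j - s then wt[g, W] else 0) =
      ∑ W : Finset κ, (wt[g, W] - (if ∑ k ∈ W, a k ≤ j - s then wt[g, W] else 0)) := by
    rw [Finset.sum_sub_distrib, IndepBlob.sum_bernoulliWeight g]
  rw [h1]
  refine Finset.sum_congr rfl fun W _ => ?_
  by_cases h : ∑ k ∈ W, a k ≤ j - s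
  · rw [if_pos h, if_neg (by omega), mul_zero, sub_self]
  · rw [if_neg h, if_pos (by omega), mul_one, sub_zero]

/-- **FAR for independent blobs with a sure shift** (`Quant.IndepBlob.far_indepBlob_support` at layer `j − s`).  Gates in `[0,1]`,
every non-empty blob's gate `≥ x`, `x ≤ 1`, and the budget `2j < 2s + Σ_k a k·g k` (a sure relay is worth 2, a blob relay `g`):
then `x ≤ TERM[s, a, g, j]`. [this work] -/
theorem term_ge_of_budget (s : ℕ) (a : κ → ℕ) (g : κ → ℝ) (j : ℕ) (x : ℝ) (hx1 : x ≤ 1)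
    (hg : ∀ k, 0 ≤ g k ∧ g k ≤ 1) (hfloor : ∀ k, a k ≠ 0 → x ≤ g k)
    (hbudget : (2 * j : ℝ) < 2 * s + ∑ k, (a k : ℝ) * g k) : x ≤ TERM[s, a, g, j] := by
  by_cases hs : j + 1 ≤ s
  · rw [term_eq_one_of_sure s a g j hs]; exact hx1
  have hsj : s ≤ j := by omega
  rw [term_eq_one_sub s a g j hsj]
  -- the budget at layer `j − s`
  have hj' : (2 * ((j - s : ℕ) : ℝ)) < ∑ k, (a k : ℝ) * g k := by
    rw [Nat.cast_sub hsj]; linarith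
  -- a non-empty blob exists; take the least gate among the non-empty blobs
  have hne : (Finset.univ.filter fun k => a k ≠ 0).Nonempty := by
    by_contra hemp
    rw [Finset.not_nonempty_iff_eq_empty, Finset.filter_eq_empty_iff] at hemp
    have h0 : ∑ k, (a k : ℝ) * g k = 0 :=
      Finset.sum_eq_zero fun k _ => by rw [show a k = 0 from not_not.1 (hemp (Finset.mem_univ k)), Nat.cast_zero, zero_mul]
    rw [h0] at hj'
    have : (0 : ℝ) ≤ 2 * ((j - s : ℕ) : ℝ) := by positivity
    linarith
  obtain ⟨y, hy, hymin⟩ := Finset.exists_min_image _ g hne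
  have hay : a y ≠ 0 := (Finset.mem_filter.1 hy).2
  have key := IndepBlob.far_indepBlob_support g (fun k => (a k : ℝ)) (fun k => (hg k).1) (fun k => (hg k).2)
    (fun k => Nat.cast_nonneg (a k)) y (Nat.cast_ne_zero.2 hay)
    (fun k hk => hymin k (Finset.mem_filter.2 ⟨Finset.mem_univ k, fun h => hk (by rw [h, Nat.cast_zero])⟩))
    ((j - s : ℕ) : ℝ) hj'
  -- the two small-ball events coincide
  have hfilt : (Finset.univ : Finset (Finset κ)).filter (fun W => ∑ k ∈ W, (a k : ℝ) ≤ ((j - s : ℕ) : ℝ)) =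
      (Finset.univ : Finset (Finset κ)).filter (fun W => ∑ k ∈ W, a k ≤ j - s) := by
    ext W
    simp only [Finset.mem_filter, Finset.mem_univ, true_and]
    rw [← Nat.cast_sum, Nat.cast_le]
  rw [hfilt] at key
  linarith [hfloor y hay]

/-! ### 4. The heavy + sure row -/

/-- **R2 — THE HEAVY + SURE ROW (unconditional).**  Structure laws `μ k = Σ_r λ k r · TP[lo k r, hi k r, g k r]` (`λ ≥ 0`, `Σ_r λ = 1`,
`lo ≤ hi ≤ M k`); for every genuine component (`λ k r > 0`): gate in `[0,1]`, HEAVY (`x ≤ g k r`) unless the blob is empty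
(`lo = hi`), and CREDIT `cr k ≤ 2·lo + (hi − lo)·g`; budget `2j < Σ_k cr k`; `x ≤ 1`.  Then `x ≤ RTAIL[M, μ, j]`.
With `cr k = E(structure k)` this is FAR at the root for every forest whose trees admit a heavy two-point decomposition with
sure credit (README V185/V186; ARCH-TREES-G49 §2 without light components). [this work] -/
theorem rtail_ge_of_heavyDec {ρ : Type*} [Fintype ρ] [DecidableEq ρ] (M : κ → ℕ) (μ : κ → ℕ → ℝ) (lam : κ → ρ → ℝ)
    (lo hi : κ → ρ → ℕ) (g : κ → ρ → ℝ) (cr : κ → ℝ) (j : ℕ) (x : ℝ) (hx1 : x ≤ 1)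
    (hlam0 : ∀ k r, 0 ≤ lam k r) (hlam1 : ∀ k, ∑ r, lam k r = 1)
    (hμ : ∀ k h, μ k h = ∑ r, lam k r * TP[lo k r, hi k r, g k r, h])
    (hlohi : ∀ k r, lo k r ≤ hi k r) (hhi : ∀ k r, hi k r ≤ M k)
    (hg : ∀ k r, 0 < lam k r → 0 ≤ g k r ∧ g k r ≤ 1)
    (hheavy : ∀ k r, 0 < lam k r → lo k r < hi k r → x ≤ g k r)
    (hcredit : ∀ k r, 0 < lam k r → cr k ≤ 2 * (lo k r : ℝ) + ((hi k r : ℝ) - lo k r) * g k r)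
    (hbudget : (2 * j : ℝ) < ∑ k, cr k) :
    x ≤ RTAIL[M, μ, j] := by
  refine rtail_ge_of_terms M μ lam lo hi g hlam0 hlam1 hμ hlohi hhi j x fun σ hpos => ?_
  refine term_ge_of_budget _ _ _ j x hx1 (fun k => hg k (σ k) (hpos k)) (fun k hk => hheavy k (σ k) (hpos k) ?_) ?_
  · by_contra hle
    exact hk (Nat.sub_eq_zero_of_le (not_lt.1 hle))
  · calc (2 * j : ℝ) < ∑ k, cr k := hbudget
      _ ≤ ∑ k, (2 * (lo k (σ k) : ℝ) + ((hi k (σ k) : ℝ) - lo k (σ k)) * g k (σ k)) :=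
          Finset.sum_le_sum fun k _ => hcredit k (σ k) (hpos k)
      _ = 2 * ((∑ k, lo k (σ k) : ℕ) : ℝ) + ∑ k, ((hi k (σ k) - lo k (σ k) : ℕ) : ℝ) * g k (σ k) := by
          rw [Nat.cast_sum, Finset.mul_sum, ← Finset.sum_add_distrib]
          exact Finset.sum_congr rfl fun k _ => by rw [Nat.cast_sub (hlohi k (σ k))]

end RootDec

end Quant

end Summit.CriticalPhenomena.PercolationContinuityZ3.Theorems
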